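import Literature.MathematicalPhysics.QuantumFieldTheory.LatticeMaxwellGaussian

/-!
# LINE-18 (crux `AllWindowsColdBox.BulkMidWindowSU2`, ⟨stmt-QuantumFields-24006⟩), toward the gauge-invariant flux maximum
# principle K3″: the TRANSFINITE (Boolean-sum) extension of a 1-form from the tangential faces of the enlarged box

Enlarged vertex box `Λ⁺ = {−1,…,2H+1}⁴`.  For an edge function `ϑ` and a direction `j`, the component `z ↦ ϑ (z, j)` is
extended from the three TANGENTIAL face pairs `{z_k = −1}`, `{z_k = 2H+1}` (`k ≠ j`) into the box by the Boolean sum of the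
one-dimensional linear interpolations `P_k` (`transfiniteA`):  `A_j = ϑ_j − Q_a Q_b Q_c ϑ_j`, `Q_k = 1 − P_k`,
`{a,b,c} = {0,1,2,3} ∖ {j}`.  Results:

* `transfiniteA_eq_of_extremal` — `A = ϑ` on every edge `(y, j)` with an extremal coordinate `y_k ∈ {−1, 2H+1}`, `k ≠ j`
  (tangential shell edges);
* `sCirc_transfiniteA_eq` — the curvature identity
  `dA_{ij} = (1 − Q_kQ_l)(dϑ)_{ij} + (2H+2)⁻¹ · Q_kQ_l (D_iϑ_j − D_jϑ_i)`, `{k,l} = {0,1,2,3} ∖ {i,j}`,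
  `D_i f (y) = f(y|_{y_i=2H+1}) − f(y|_{y_i=−1})`: the first term only evaluates `dϑ` on SHELL plaquettes, the second only
  shell VALUES divided by the side length;
* `abs_sCirc_transfiniteA_le` — hence `|dA| ≤ 3ε + 16V/(2H+2)` on every plaquette of `Λ⁺` whenever `|dϑ| ≤ ε` on the shell
  plaquettes and `|ϑ| ≤ V` on the tangential shell edges.

Elementary algebra of the interpolation operators; no measure theory.  HONEST LABEL: helper toward an UNREGISTERED internal
obligation (K3″) of a critic-passed DRAFT line on the R2ξ″ RECORD-rung crux 24006; no stub, crux, rung or summit is proved here;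
the Yang–Mills mass gap is NOT proved by this file.
-/

set_option autoImplicit false

noncomputable section

open Finset Function
open Literature.Probability.LatticeModels (Site)
open Literature.MathematicalPhysics.QuantumFieldTheory
open Literature.MathematicalPhysics.QuantumFieldTheory.LatticeMaxwell

namespace Summit.QuantumFields.YangMills.Theorems.AllWindowsColdBoxBulkMidLine.FluxExt

variable (H : ℕ)

/-! ## The one-dimensional interpolation operators -/

/-- Linear interpolation in coordinate `k` between the two faces `y_k = −1` and `y_k = 2H+1` of the enlarged box. -/
def P (k : Fin 4) (f : Site 4 → ℝ) (y : Site 4) : ℝ :=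
  ((2 * (H : ℝ) + 1 - (y k : ℝ)) / (2 * H + 2)) * f (update y k (-1)) +
    (((y k : ℝ) + 1) / (2 * H + 2)) * f (update y k (2 * (H : ℤ) + 1))

/-- The complementary operator `Q_k = 1 − P_k`. -/
def Q (k : Fin 4) (f : Site 4 → ℝ) (y : Site 4) : ℝ := f y - P H k f y

/-- Forward difference in direction `i`. -/
def Δ (i : Fin 4) (f : Site 4 → ℝ) (y : Site 4) : ℝ := f (y + Pi.single i 1) - f y

/-- Face-to-face difference in direction `i`: `f(y|_{y_i = 2H+1}) − f(y|_{y_i = −1})`. -/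
def D (i : Fin 4) (f : Site 4 → ℝ) (y : Site 4) : ℝ := f (update y i (2 * (H : ℤ) + 1)) - f (update y i (-1))

variable {H}

section Algebra

variable (f g : Site 4 → ℝ)

/-- Updating coordinate `k` commutes with a unit step in direction `i ≠ k`. -/
theorem update_add_single_of_ne {i k : Fin 4} (hik : i ≠ k) (y : Site 4) (c : ℤ) :
    update (y + Pi.single i (1 : ℤ)) k c = update y k c + Pi.single i 1 := by
  ext m
  by_cases hm : m = k
  · subst hm; simp [hik]
  · simp [hm]

/-- A unit step in direction `i` does not change coordinate `k ≠ i`. -/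
theorem add_single_apply_of_ne {i k : Fin 4} (hik : i ≠ k) (y : Site 4) :
    (y + Pi.single i (1 : ℤ) : Site 4) k = y k := by
  simp [hik.symm]

/-- A unit step in direction `i` raises coordinate `i` by one. -/
theorem add_single_apply_self (i : Fin 4) (y : Site 4) : (y + Pi.single i (1 : ℤ) : Site 4) i = y i + 1 := by simp

/-- Updating coordinate `i` forgets a unit step in direction `i`. -/
theorem update_add_single_self (i : Fin 4) (y : Site 4) (c : ℤ) :
    update (y + Pi.single i (1 : ℤ)) i c = update y i c := by
  ext m
  by_cases hm : m = i
  · subst hm; simp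
  · simp [hm]

/-- `P_k` and `P_l` commute. -/
theorem P_comm {k l : Fin 4} (hkl : k ≠ l) : P H k (P H l f) = P H l (P H k f) := by
  funext y
  simp only [P, update_of_ne hkl, update_of_ne hkl.symm]
  rw [update_comm hkl.symm (-1 : ℤ) (-1 : ℤ) y, update_comm hkl.symm (-1 : ℤ) (2 * (H : ℤ) + 1) y,
    update_comm hkl.symm (2 * (H : ℤ) + 1) (-1 : ℤ) y, update_comm hkl.symm (2 * (H : ℤ) + 1) (2 * (H : ℤ) + 1) y]
  ring

/-- `P_k` is additive. -/
theorem P_sub {k : Fin 4} : P H k (f - g) = P H k f - P H k g := by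
  funext y; simp only [P, Pi.sub_apply]; ring

/-- `Q_k` is additive. -/
theorem Q_sub {k : Fin 4} : Q H k (f - g) = Q H k f - Q H k g := by
  funext y; simp only [Q, P, Pi.sub_apply]; ring

/-- `Q_k` and `Q_l` commute. -/
theorem Q_comm {k l : Fin 4} (hkl : k ≠ l) : Q H k (Q H l f) = Q H l (Q H k f) := by
  have h := congr_fun (P_comm (H := H) f hkl)
  have hl : Q H l f = f - P H l f := rfl
  have hk : Q H k f = f - P H k f := rfl
  funext y
  simp only [Q]
  rw [hl, hk, P_sub, P_sub, Pi.sub_apply, Pi.sub_apply, h y]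
  ring

/-- `Δ_i` commutes with `P_k` for `k ≠ i`. -/
theorem Δ_P {i k : Fin 4} (hik : i ≠ k) : Δ i (P H k f) = P H k (Δ i f) := by
  funext y
  simp only [Δ, P, update_add_single_of_ne hik, add_single_apply_of_ne hik]
  ring

/-- `Δ_i P_i = (2H+2)⁻¹ D_i`. -/
theorem Δ_P_self (i : Fin 4) (y : Site 4) : Δ i (P H i f) y = (1 / (2 * H + 2)) * D H i f y := by
  simp only [Δ, P, D, update_add_single_self, add_single_apply_self]
  have hne : (2 * (H : ℝ) + 2) ≠ 0 := by positivity
  push_cast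
  field_simp
  ring

/-- `D_i` commutes with `P_k` for `k ≠ i`. -/
theorem D_P {i k : Fin 4} (hik : i ≠ k) : D H i (P H k f) = P H k (D H i f) := by
  funext y
  simp only [D, P, update_of_ne hik.symm]
  rw [update_comm hik (2 * (H : ℤ) + 1) (-1 : ℤ) y, update_comm hik (2 * (H : ℤ) + 1) (2 * (H : ℤ) + 1) y,
    update_comm hik (-1 : ℤ) (-1 : ℤ) y, update_comm hik (-1 : ℤ) (2 * (H : ℤ) + 1) y]
  ring

/-- `Δ_i` commutes with `Q_k` for `k ≠ i`. -/
theorem Δ_Q {i k : Fin 4} (hik : i ≠ k) : Δ i (Q H k f) = Q H k (Δ i f) := by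
  funext y
  have := congr_fun (Δ_P (H := H) f hik) y
  simp only [Δ, Q] at this ⊢
  linarith

/-- `Δ_i Q_i = Δ_i − (2H+2)⁻¹ D_i`. -/
theorem Δ_Q_self (i : Fin 4) (y : Site 4) : Δ i (Q H i f) y = Δ i f y - (1 / (2 * H + 2)) * D H i f y := by
  have := Δ_P_self (H := H) f i y
  simp only [Δ, Q] at this ⊢
  linarith

/-- `D_i` commutes with `Q_k` for `k ≠ i`. -/
theorem D_Q {i k : Fin 4} (hik : i ≠ k) : D H i (Q H k f) = Q H k (D H i f) := by
  funext y
  have := congr_fun (D_P (H := H) f hik) y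
  simp only [D, Q] at this ⊢
  linarith

/-- `Δ_i` is additive. -/
theorem Δ_sub (i : Fin 4) : Δ i (f - g) = Δ i f - Δ i g := by
  funext y; simp only [Δ, Pi.sub_apply]; ring

/-- **The curvature identity of the transfinite extension** (operator form): for pairwise distinct `i, j, k, l`,
`Δ_i (f − Q_iQ_kQ_l f) − Δ_j (g − Q_jQ_kQ_l g) = (Δ_i f − Δ_j g) − Q_kQ_l(Δ_i f − Δ_j g) + (2H+2)⁻¹ Q_kQ_l (D_i f − D_j g)`. -/
theorem curvature_identity {i j k l : Fin 4} (hik : i ≠ k) (hil : i ≠ l) (hjk : j ≠ k) (hjl : j ≠ l) (y : Site 4) :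
    Δ i (f - Q H i (Q H k (Q H l f))) y - Δ j (g - Q H j (Q H k (Q H l g))) y =
      ((Δ i f y - Δ j g y) - Q H k (Q H l (Δ i f - Δ j g)) y) +
        (1 / (2 * H + 2)) * Q H k (Q H l (D H i f - D H j g)) y := by
  have h1 : Δ i (f - Q H i (Q H k (Q H l f))) y =
      Δ i f y - (Q H k (Q H l (Δ i f)) y - (1 / (2 * H + 2)) * Q H k (Q H l (D H i f)) y) := by
    rw [Δ_sub, Pi.sub_apply, Δ_Q_self, Δ_Q _ hik, Δ_Q _ hil, D_Q _ hik, D_Q _ hil]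
  have h2 : Δ j (g - Q H j (Q H k (Q H l g))) y =
      Δ j g y - (Q H k (Q H l (Δ j g)) y - (1 / (2 * H + 2)) * Q H k (Q H l (D H j g)) y) := by
    rw [Δ_sub, Pi.sub_apply, Δ_Q_self, Δ_Q _ hjk, Δ_Q _ hjl, D_Q _ hjk, D_Q _ hjl]
  rw [h1, h2]
  simp only [Q_sub, Pi.sub_apply]
  ring

end Algebra

/-! ## Vanishing of `Q`-products at extremal points -/

/-- `P_k f = f` at `k`-extremal points. -/
theorem P_apply_of_extremal (k : Fin 4) (f : Site 4 → ℝ) {y : Site 4} (hy : y k = -1 ∨ y k = 2 * (H : ℤ) + 1) :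
    P H k f y = f y := by
  have hne : (2 * (H : ℝ) + 2) ≠ 0 := by positivity
  rcases hy with hy | hy
  · have h1 : update y k (-1 : ℤ) = y := by rw [← hy, update_eq_self]
    simp only [P, hy, h1]; push_cast
    field_simp
    ring
  · have h1 : update y k (2 * (H : ℤ) + 1) = y := by rw [← hy, update_eq_self]
    simp only [P, hy, h1]; push_cast
    field_simp
    ring

/-- `Q_k g` vanishes at every point whose `k`-th coordinate is extremal. -/
theorem vanishesAt_Q_self (k : Fin 4) (f : Site 4 → ℝ) :
    ∀ y : Site 4, (y k = -1 ∨ y k = 2 * (H : ℤ) + 1) → Q H k f y = 0 := by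
  intro y hy
  simp only [Q, P_apply_of_extremal k f hy, sub_self]

/-- `Q_a` (`a ≠ k`) preserves vanishing at `k`-extremal points. -/
theorem vanishesAt_Q_of_ne {a k : Fin 4} (hak : a ≠ k) {g : Site 4 → ℝ}
    (hg : ∀ y : Site 4, (y k = -1 ∨ y k = 2 * (H : ℤ) + 1) → g y = 0) :
    ∀ y : Site 4, (y k = -1 ∨ y k = 2 * (H : ℤ) + 1) → Q H a g y = 0 := by
  intro y hy
  have h0 : g y = 0 := hg y hy
  have h1 : g (update y a (-1)) = 0 := hg _ (by simpa [update_of_ne hak.symm] using hy)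
  have h2 : g (update y a (2 * (H : ℤ) + 1)) = 0 := hg _ (by simpa [update_of_ne hak.symm] using hy)
  simp only [Q, P, h0, h1, h2, mul_zero, add_zero, sub_self]

/-- A triple product `Q_aQ_bQ_c` containing `Q_k` vanishes at `k`-extremal points. -/
theorem Q3_apply_eq_zero {a b c k : Fin 4} (hk : k = a ∨ k = b ∨ k = c) (hab : a ≠ b) (hac : a ≠ c) (hbc : b ≠ c)
    (f : Site 4 → ℝ) {y : Site 4} (hy : y k = -1 ∨ y k = 2 * (H : ℤ) + 1) :
    Q H a (Q H b (Q H c f)) y = 0 := by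
  rcases hk with rfl | rfl | rfl
  · exact vanishesAt_Q_self k _ y hy
  · exact vanishesAt_Q_of_ne hab (vanishesAt_Q_self k _) y hy
  · exact vanishesAt_Q_of_ne hac (vanishesAt_Q_of_ne (H := H) hbc (vanishesAt_Q_self k _)) y hy

/-! ## The extension -/

/-- The three coordinates other than `j`, in increasing order. -/
def o1 (j : Fin 4) : Fin 4 := if j = 0 then 1 else 0
/-- See `o1`. -/
def o2 (j : Fin 4) : Fin 4 := if j.val ≤ 1 then 2 else 1
/-- See `o1`. -/
def o3 (j : Fin 4) : Fin 4 := if j = 3 then 2 else 3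

/-- The `j`-component of an edge function as a function of the base point. -/
def comp (ϑ : Literature.MathematicalPhysics.QuantumLattice.ZdEdge 4 → ℝ) (j : Fin 4) : Site 4 → ℝ := fun z => ϑ (z, j)

/-- **The transfinite extension** of the edge function `ϑ` from the tangential faces of the enlarged box `{−1,…,2H+1}⁴`:
`A (y, j) = ϑ_j(y) − (Q_a Q_b Q_c ϑ_j)(y)` with `{a,b,c}` the coordinates other than `j`. -/
def transfiniteA (H : ℕ) (ϑ : Literature.MathematicalPhysics.QuantumLattice.ZdEdge 4 → ℝ) :
    Literature.MathematicalPhysics.QuantumLattice.ZdEdge 4 → ℝ :=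
  fun e => comp ϑ e.2 e.1 - Q H (o1 e.2) (Q H (o2 e.2) (Q H (o3 e.2) (comp ϑ e.2))) e.1

variable (ϑ : Literature.MathematicalPhysics.QuantumLattice.ZdEdge 4 → ℝ)

/-- `o1 j, o2 j, o3 j` are the three coordinates other than `j`, pairwise distinct. -/
theorem o_spec (j : Fin 4) :
    o1 j ≠ j ∧ o2 j ≠ j ∧ o3 j ≠ j ∧ o1 j ≠ o2 j ∧ o1 j ≠ o3 j ∧ o2 j ≠ o3 j ∧
      ∀ k : Fin 4, k ≠ j → (k = o1 j ∨ k = o2 j ∨ k = o3 j) := by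
  fin_cases j <;> simp [o1, o2, o3] <;> decide

/-- **`A = ϑ` on tangential shell edges**: if some coordinate `k ≠ j` of `y` is extremal then `transfiniteA H ϑ (y, j) = ϑ (y, j)`. -/
theorem transfiniteA_eq_of_extremal {y : Site 4} {j k : Fin 4} (hkj : k ≠ j)
    (hy : y k = -1 ∨ y k = 2 * (H : ℤ) + 1) : transfiniteA H ϑ (y, j) = ϑ (y, j) := by
  obtain ⟨-, -, -, h12, h13, h23, hall⟩ := o_spec j
  have h0 := Q3_apply_eq_zero (H := H) (hall k hkj) h12 h13 h23 (comp ϑ j) hy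
  simp only [transfiniteA, h0, sub_zero, comp]

/-- The component function of `transfiniteA` in direction `j`, with the `Q`-product written for an arbitrary admissible
ordered triple `(i, k, l)` of the other coordinates (the operators commute). -/
theorem comp_transfiniteA_eq {i j k l : Fin 4} (hij : i ≠ j) (hkj : k ≠ j) (hlj : l ≠ j) (hik : i ≠ k) (hil : i ≠ l)
    (hkl : k ≠ l) :
    comp (transfiniteA H ϑ) j = comp ϑ j - Q H i (Q H k (Q H l (comp ϑ j))) := by
  funext y
  simp only [comp, transfiniteA, Pi.sub_apply]
  congr 1
  have c10 : ∀ g : Site 4 → ℝ, Q H 1 (Q H 0 g) = Q H 0 (Q H 1 g) := fun g => Q_comm g (by decide)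
  have c20 : ∀ g : Site 4 → ℝ, Q H 2 (Q H 0 g) = Q H 0 (Q H 2 g) := fun g => Q_comm g (by decide)
  have c30 : ∀ g : Site 4 → ℝ, Q H 3 (Q H 0 g) = Q H 0 (Q H 3 g) := fun g => Q_comm g (by decide)
  have c21 : ∀ g : Site 4 → ℝ, Q H 2 (Q H 1 g) = Q H 1 (Q H 2 g) := fun g => Q_comm g (by decide)
  have c31 : ∀ g : Site 4 → ℝ, Q H 3 (Q H 1 g) = Q H 1 (Q H 3 g) := fun g => Q_comm g (by decide)
  have c32 : ∀ g : Site 4 → ℝ, Q H 3 (Q H 2 g) = Q H 2 (Q H 3 g) := fun g => Q_comm g (by decide)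
  fin_cases i <;> fin_cases j <;> fin_cases k <;> fin_cases l <;>
    simp (config := { decide := true }) only [o1, o2, o3] at hij hkj hlj hik hil hkl ⊢ <;>
    simp only [c10, c20, c30, c21, c31, c32, Fin.isValue, Fin.zero_eta, Fin.mk_one, Fin.reduceFinMk, if_true, if_false]

/-! ## The curvature of the extension -/

/-- The circulation as a difference of forward differences: `dA_{ij} = Δ_i A_j − Δ_j A_i`. -/
theorem sCirc_eq_Δ (A : Literature.MathematicalPhysics.QuantumLattice.ZdEdge 4 → ℝ) (y : Site 4) (i j : Fin 4) :
    sCirc A (y, i, j) = Δ i (comp A j) y - Δ j (comp A i) y := by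
  simp only [sCirc, Δ, comp]; ring

/-- For `i ≠ j` in `Fin 4` there are two further coordinates `k ≠ l` completing `{i,j}` to `{0,1,2,3}`. -/
theorem exists_other_two {i j : Fin 4} (hij : i ≠ j) :
    ∃ k l : Fin 4, k ≠ i ∧ k ≠ j ∧ l ≠ i ∧ l ≠ j ∧ k ≠ l := by
  revert hij; revert i j; decide

/-- **The curvature identity** of `transfiniteA`: for pairwise distinct `i, j, k, l`,
`dA(y;i,j) = [dϑ_{ij} − Q_kQ_l dϑ_{ij}](y) + (2H+2)⁻¹ · [Q_kQ_l (D_iϑ_j − D_jϑ_i)](y)`. -/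
theorem sCirc_transfiniteA_eq {i j k l : Fin 4} (hij : i ≠ j) (hik : i ≠ k) (hil : i ≠ l) (hjk : j ≠ k) (hjl : j ≠ l)
    (hkl : k ≠ l) (y : Site 4) :
    sCirc (transfiniteA H ϑ) (y, i, j) =
      ((sCirc ϑ (y, i, j)) - Q H k (Q H l (fun z => sCirc ϑ (z, i, j))) y) +
        (1 / (2 * H + 2)) * Q H k (Q H l (D H i (comp ϑ j) - D H j (comp ϑ i))) y := by
  have hg : (fun z => sCirc ϑ (z, i, j)) = Δ i (comp ϑ j) - Δ j (comp ϑ i) := by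
    funext z; simp only [sCirc_eq_Δ, Pi.sub_apply]
  rw [sCirc_eq_Δ, comp_transfiniteA_eq ϑ hij hjk.symm hjl.symm hik hil hkl,
    comp_transfiniteA_eq ϑ hij.symm hik.symm hil.symm hjk hjl hkl, curvature_identity _ _ hik hil hjk hjl, hg, sCirc_eq_Δ]

end Summit.QuantumFields.YangMills.Theorems.AllWindowsColdBoxBulkMidLine.FluxExt

end
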